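import Literature.AnabelianGeometry.AbsoluteAnabelian.AbsTopII.InertiaGroupsScope

/-!
# [AbsTopII] Prop 1.3 (viii), (x): when the `Π_H`-scope (v1) typings ARE implied by the printed `Π_𝔾`-scope (v2) forms

S. Mochizuki, *Topics in Absolute Anabelian Geometry II* [AbsTopII] (bib `MochizukiAbsTopII2013`;
locators = PDF pages of the kurims manuscript `paper:url-585b8d0ad0d9`), §1, Def 1.2 (ii) p. 10,
Prop 1.3 (viii), (x) p. 12.

Erratum E-L4-9 (L4-lead RULING #5b, 2026-08-26; finding F-L4t6g5-1, kernel certificates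
`AbsTopII/Prop13ConjugacyScope.lean` p425481): the v1 typings `DPSCIndexData.Prop_1_3_viii` /
`Prop_1_3_x` (`AbsTopII/InertiaGroups.lean`) quantify the conjugating element over `Π_H`, the printed
statements (v2: `Prop_1_3_viii'` / `Prop_1_3_x'`, `AbsTopII/InertiaGroupsScope.lean`) over `Π_𝔾`.
This proof-only file records the BRIDGE asked for by the ruling: whenever the outer action of `H`
on `𝔾` is trivial on edges / vertices UP TO `Π_𝔾`-CONJUGACY — i.e. every `Π_H`-conjugate of a
decomposition (resp. inertia) group is already a `Π_𝔾`-conjugate of the SAME group (e.g. `H = I`,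
or `ρ_H(H)` acting trivially on the underlying semi-graph) — the v2 forms imply the v1 forms; and,
unconditionally, v1 implies the dichotomy part of v2 (v1 is the stronger statement).  No new
definition; the "triviality up to `Π_𝔾`-conjugacy" conditions are explicit hypotheses.
HONEST FRAMING: bookkeeping between two typings of one printed statement; typed ≠ proved; nothing
here bears on [IUTchIII] Cor 3.12.
-/

open scoped Pointwise

universe u

namespace Literature.AnabelianGeometry.AbsoluteAnabelian.AbsTopII

namespace DPSCIndexData

variable (X : DPSCIndexData.{u})

/-- v2 ⇒ v1 for (viii), GIVEN that every `Π_H`-conjugate of an edge decomposition group `D_e` is a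
`Π_𝔾`-conjugate of `D_e` (the outer `H`-action fixes every edge up to `Π_𝔾`-conjugacy, e.g. `H = I`).
[cite: MochizukiAbsTopII2013, Prop 1.3 (viii) p.12] -/
theorem prop_1_3_viii_of_prop_1_3_viii' (h : X.Prop_1_3_viii')
    (htriv : ∀ (g : X.PiH) (e : X.Edge), ∃ γ : X.PiH, γ ∈ X.PiG ∧
      MulAut.conj g • X.DEdge e = MulAut.conj γ • X.DEdge e) :
    X.Prop_1_3_viii := by
  intro e e' g hne
  obtain ⟨γ, hγ, hγeq⟩ := htriv g e'
  rw [hγeq] at hne ⊢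
  rcases h e e' γ hγ hne with h1 | ⟨h2, v, ha, hb, hc, k, -, hkeq⟩
  · exact Or.inl h1
  · exact Or.inr ⟨h2, v, ha, hb, hc, k, hkeq⟩

/-- v1 ⇒ the dichotomy of v2 for (viii), unconditionally (v1 quantifies over MORE conjugates; only
the `h ∈ Π_𝔾` refinement of the "moreover" clause is not supplied by v1).
[cite: MochizukiAbsTopII2013, Prop 1.3 (viii) p.12] -/
theorem prop_1_3_viii'_dichotomy_of_prop_1_3_viii (h : X.Prop_1_3_viii) (e e' : X.Edge) (γ : X.PiH)
    (hne : X.DEdge e ⊓ MulAut.conj γ • X.DEdge e' ⊓ X.PiI ≠ ⊥) :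
    e = e' ∨ (e ≠ e' ∧ ∃ v : X.Vert, X.EdgeAbuts e v ∧ X.EdgeAbuts e' v ∧
      X.DEdge e ⊓ MulAut.conj γ • X.DEdge e' ⊓ X.PiG = ⊥) := by
  rcases h e e' γ hne with h1 | ⟨h2, v, ha, hb, hc, -⟩
  · exact Or.inl h1
  · exact Or.inr ⟨h2, v, ha, hb, hc⟩

/-- v2 ⇒ v1 for (x), GIVEN that every `Π_H`-conjugate of a cusp decomposition group `D_e`, of a
vertex inertia group `I_v`, and of a node inertia group `I_e` is a `Π_𝔾`-conjugate of the same group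
(outer `H`-action trivial on the underlying semi-graph up to `Π_𝔾`-conjugacy, e.g. `H = I`).
[cite: MochizukiAbsTopII2013, Prop 1.3 (x) p.12] -/
theorem prop_1_3_x_of_prop_1_3_x' (h : X.Prop_1_3_x')
    (htrivC : ∀ (g : X.PiH) (e : X.Cusp), ∃ γ : X.PiH, γ ∈ X.PiG ∧
      MulAut.conj g • X.DvCusp e = MulAut.conj γ • X.DvCusp e)
    (htrivV : ∀ (g : X.PiH) (v : X.Vert), ∃ γ : X.PiH, γ ∈ X.PiG ∧
      MulAut.conj g • X.Iv v = MulAut.conj γ • X.Iv v)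
    (htrivN : ∀ (g : X.PiH) (e : X.Node), ∃ γ : X.PiH, γ ∈ X.PiG ∧
      MulAut.conj g • X.IvNode e = MulAut.conj γ • X.IvNode e) :
    X.Prop_1_3_x := by
  intro τ
  obtain ⟨h1, h2⟩ := h τ
  refine ⟨fun hv he => ?_, fun hnc => ?_⟩
  · obtain ⟨e, hk, huniq⟩ := h1 hv he
    refine ⟨e, hk, fun e' => ⟨?_, fun he' => ?_⟩⟩
    · rintro ⟨g, hg⟩
      obtain ⟨γ, hγ, hγeq⟩ := htrivC g e'
      rw [hγeq] at hg
      exact (huniq e').mp ⟨γ, hγ, hg⟩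
    · obtain ⟨γ, -, hle⟩ := (huniq e').mpr he'
      exact ⟨γ, hle⟩
  · obtain ⟨hV, hN⟩ := h2 hnc
    refine ⟨fun v => ⟨?_, fun hk => ?_⟩, fun e => ⟨?_, fun hk => ?_⟩⟩
    · rintro ⟨g, hg⟩
      obtain ⟨γ, hγ, hγeq⟩ := htrivV g v
      rw [hγeq] at hg
      exact (hV v).mp ⟨γ, hγ, hg⟩
    · obtain ⟨γ, -, heq⟩ := (hV v).mpr hk
      exact ⟨γ, heq⟩
    · rintro ⟨hnv, g, hg⟩
      obtain ⟨γ, hγ, hγeq⟩ := htrivN g e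
      rw [hγeq] at hg
      exact (hN e).mp ⟨hnv, γ, hγ, hg⟩
    · obtain ⟨hnv, γ, -, hle⟩ := (hN e).mpr hk
      exact ⟨hnv, γ, hle⟩

end DPSCIndexData

end Literature.AnabelianGeometry.AbsoluteAnabelian.AbsTopII
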